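import Summits.AtomisticToContinuum.Crystallization.Theorems.FrustratedLawDichotomyPeriodicBlockKernel

/-!
# FrustratedLawDichotomy · crux `AperiodicFrustratedLawGap` (stmt-AtomisticToContinuum-27623) — PERIODIC FAR FIELD in fractional coordinates:
# a Gram-minorant lower bound for distances in a periodic configuration, and `PerSep` from the 27 nearest translates
# (decomp-a2c, prover hand 2, structural share, generation 16; critic row 573 (C)(3) «support hand-1's instantiation of the negative kernel»)

The periodic-block negative kernels (`…PeriodicBlockViolation`, `…PeriodicBlockFlags`) take a cell `x : Fin N₀ → ℝ³` with lattice `a : Fin 3 → ℝ³`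
and ask (i) `PerSep x a` — EVERY pair of atoms of the infinite periodic configuration is `≥ 7/10` apart (a statement over all `s ∈ ℤ³`), and, inside
the flag and deficit certificates, (ii) lower bounds `R ≤ dist (x m) (x m' + latVec a s)` for all translations `s` outside a small box.  Part B's
dual-basis bound `|s_k| ≤ cB·‖latVec a s‖` loses the cell DIAMETER (`cB·(ϱ + diam) < k₀ + 1`); in FRACTIONAL coordinates nothing is lost:

* `norm_sq_sum_smul` — `‖Σ_k c_k • a_k‖² = Σ_j Σ_k c_j c_k ⟪a_j, a_k⟫` (the Gram form);
* ★ `dist_ge_of_box` — if `x m = x₀ + Σ_k ξ_{m,k} • a_k` with fractional spreads `|ξ_{m',k} − ξ_{m,k}| ≤ 1`, the Gram matrix `G_{jk} = ⟪a_j, a_k⟫`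
  dominates a diagonal `diag(μ)` (`Σ_k μ_k c_k² ≤ Σ_{jk} c_j c_k G_{jk}` for all real `c`, `μ ≥ 0` — an LDLᵀ / SOS certificate on rational data), then
  for every `s ∈ ℤ³`: `R² ≤ Σ_k μ_k · max(|s_k| − 1, 0)² ⟹ R ≤ dist (x m) (x m' + latVec a s)` (and the squared form `sq_le_dist_sq_of_box`);
* ★ `perSep_of_box` — `PerSep x a` from the FINITE check of the translates `s ∈ {−1,0,1}³` (`(m ≠ m' ∨ s ≠ 0) → 7/10 ≤ dist`) once `μ_k ≥ 49/100`
  for all `k` (every other translate is `≥ 7/10` away by `dist_ge_of_box`);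
* `eq_zero_of_box` — a potential vanishing from `R` on contributes nothing from translates outside the box (range cut of the deficit sums).
All `[folklore]`; 0 sorry; no definitions.
-/

noncomputable section

namespace Summit.AtomisticToContinuum.Crystallization.Theorems.FrustratedLawDichotomyPeriodicFarField

open scoped BigOperators RealInnerProductSpace
open Summit.AtomisticToContinuum.Crystallization.Theorems.ChargedEnergyGapNegative (E3)
open Summit.AtomisticToContinuum.Crystallization.Theorems.FrustratedLawDichotomyPeriodicBlockGeometry (latVec)
open Summit.AtomisticToContinuum.Crystallization.Theorems.FrustratedLawDichotomyPeriodicBlockKernel (PerSep)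

/-! ## §1. The Gram form -/

/-- **The Gram form**: `‖Σ_k c_k • a_k‖² = Σ_j Σ_k c_j c_k ⟪a_j, a_k⟫`. [folklore] -/
theorem norm_sq_sum_smul (a : Fin 3 → E3) (c : Fin 3 → ℝ) :
    ‖∑ k, c k • a k‖ ^ 2 = ∑ j, ∑ k, c j * c k * ⟪a j, a k⟫ := by
  rw [← real_inner_self_eq_norm_sq, sum_inner]
  refine Finset.sum_congr rfl fun j _ => ?_
  rw [inner_sum]
  refine Finset.sum_congr rfl fun k _ => ?_
  rw [real_inner_smul_left, real_inner_smul_right, mul_assoc]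

/-- The Gram form bounded below by a certified diagonal minorant. [folklore] -/
theorem minorant_le_norm_sq {a : Fin 3 → E3} {G : Fin 3 → Fin 3 → ℝ} (hG : ∀ j k, ⟪a j, a k⟫ = G j k) {μ : Fin 3 → ℝ}
    (hD : ∀ c : Fin 3 → ℝ, ∑ k, μ k * c k ^ 2 ≤ ∑ j, ∑ k, c j * c k * G j k) (c : Fin 3 → ℝ) :
    ∑ k, μ k * c k ^ 2 ≤ ‖∑ k, c k • a k‖ ^ 2 := by
  rw [norm_sq_sum_smul]
  have h := hD c
  simp only [← hG] at h
  exact h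

/-! ## §2. Distances to translates outside a box -/

/-- The relative vector of two atoms of the periodic configuration in fractional coordinates. [folklore] -/
theorem translate_sub_eq {N₀ : ℕ} {x : Fin N₀ → E3} {a : Fin 3 → E3} {x₀ : E3} {ξ : Fin N₀ → Fin 3 → ℝ}
    (hx : ∀ m, x m = x₀ + ∑ k, ξ m k • a k) (m m' : Fin N₀) (s : Fin 3 → ℤ) :
    x m' + latVec a s - x m = ∑ k, (ξ m' k + ((s k : ℤ) : ℝ) - ξ m k) • a k := by
  rw [hx m, hx m', latVec]
  simp only [sub_smul, add_smul, Finset.sum_add_distrib, Finset.sum_sub_distrib]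
  abel

/-- `max(|s| − 1, 0)² ≤ (ξ' + s − ξ)²` for `|ξ' − ξ| ≤ 1`. [folklore] -/
theorem max_sq_le_coord_sq {ξ ξ' σ : ℝ} (h : |ξ' - ξ| ≤ 1) : (max (|σ| - 1) 0) ^ 2 ≤ (ξ' + σ - ξ) ^ 2 := by
  have h1 : max (|σ| - 1) 0 ≤ |ξ' + σ - ξ| := by
    refine max_le ?_ (abs_nonneg _)
    have := abs_sub_abs_le_abs_sub σ (-(ξ' - ξ))
    rw [abs_neg] at this
    have e : σ - -(ξ' - ξ) = ξ' + σ - ξ := by ring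
    rw [e] at this
    linarith
  have h0 : 0 ≤ max (|σ| - 1) 0 := le_max_right _ _
  calc (max (|σ| - 1) 0) ^ 2 ≤ |ξ' + σ - ξ| ^ 2 := pow_le_pow_left₀ h0 h1 2
    _ = (ξ' + σ - ξ) ^ 2 := sq_abs _

/-- ★ **SQUARED DISTANCE TO A TRANSLATE OUTSIDE A BOX** (fractional coordinates, Gram minorant):
`Σ_k μ_k · max(|s_k| − 1, 0)² ≤ dist (x m) (x m' + latVec a s)²`. [folklore] -/
theorem sq_le_dist_sq_of_box {N₀ : ℕ} {x : Fin N₀ → E3} {a : Fin 3 → E3} {x₀ : E3} {ξ : Fin N₀ → Fin 3 → ℝ}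
    (hx : ∀ m, x m = x₀ + ∑ k, ξ m k • a k) (hξ : ∀ m m' k, |ξ m' k - ξ m k| ≤ 1) {G : Fin 3 → Fin 3 → ℝ}
    (hG : ∀ j k, ⟪a j, a k⟫ = G j k) {μ : Fin 3 → ℝ} (hμ : ∀ k, 0 ≤ μ k)
    (hD : ∀ c : Fin 3 → ℝ, ∑ k, μ k * c k ^ 2 ≤ ∑ j, ∑ k, c j * c k * G j k) (m m' : Fin N₀) (s : Fin 3 → ℤ) :
    ∑ k, μ k * (max (|((s k : ℤ) : ℝ)| - 1) 0) ^ 2 ≤ dist (x m) (x m' + latVec a s) ^ 2 := by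
  rw [dist_comm, dist_eq_norm, translate_sub_eq hx m m' s]
  refine le_trans ?_ (minorant_le_norm_sq hG hD _)
  exact Finset.sum_le_sum fun k _ => mul_le_mul_of_nonneg_left (max_sq_le_coord_sq (hξ m m' k)) (hμ k)

/-- ★ **DISTANCE TO A TRANSLATE OUTSIDE A BOX**: `R² ≤ Σ_k μ_k · max(|s_k| − 1, 0)²`, `0 ≤ R` ⟹ `R ≤ dist (x m) (x m' + latVec a s)`. [folklore] -/
theorem dist_ge_of_box {N₀ : ℕ} {x : Fin N₀ → E3} {a : Fin 3 → E3} {x₀ : E3} {ξ : Fin N₀ → Fin 3 → ℝ}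
    (hx : ∀ m, x m = x₀ + ∑ k, ξ m k • a k) (hξ : ∀ m m' k, |ξ m' k - ξ m k| ≤ 1) {G : Fin 3 → Fin 3 → ℝ}
    (hG : ∀ j k, ⟪a j, a k⟫ = G j k) {μ : Fin 3 → ℝ} (hμ : ∀ k, 0 ≤ μ k)
    (hD : ∀ c : Fin 3 → ℝ, ∑ k, μ k * c k ^ 2 ≤ ∑ j, ∑ k, c j * c k * G j k) {R : ℝ} (hR : 0 ≤ R) (m m' : Fin N₀) (s : Fin 3 → ℤ)
    (hfar : R ^ 2 ≤ ∑ k, μ k * (max (|((s k : ℤ) : ℝ)| - 1) 0) ^ 2) : R ≤ dist (x m) (x m' + latVec a s) :=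
  (pow_le_pow_iff_left₀ hR dist_nonneg two_ne_zero).1 (hfar.trans (sq_le_dist_sq_of_box hx hξ hG hμ hD m m' s))

/-- A translate with SOME coordinate `|s_k| ≥ 2` is at squared distance `≥ μ_k`. [folklore] -/
theorem mu_le_dist_sq_of_two_le {N₀ : ℕ} {x : Fin N₀ → E3} {a : Fin 3 → E3} {x₀ : E3} {ξ : Fin N₀ → Fin 3 → ℝ}
    (hx : ∀ m, x m = x₀ + ∑ k, ξ m k • a k) (hξ : ∀ m m' k, |ξ m' k - ξ m k| ≤ 1) {G : Fin 3 → Fin 3 → ℝ}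
    (hG : ∀ j k, ⟪a j, a k⟫ = G j k) {μ : Fin 3 → ℝ} (hμ : ∀ k, 0 ≤ μ k)
    (hD : ∀ c : Fin 3 → ℝ, ∑ k, μ k * c k ^ 2 ≤ ∑ j, ∑ k, c j * c k * G j k) (m m' : Fin N₀) {s : Fin 3 → ℤ} {k : Fin 3}
    (hk : 2 ≤ |s k|) : μ k ≤ dist (x m) (x m' + latVec a s) ^ 2 := by
  refine le_trans ?_ (sq_le_dist_sq_of_box hx hξ hG hμ hD m m' s)
  have hk' : (2 : ℝ) ≤ |((s k : ℤ) : ℝ)| := by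
    rw [← Int.cast_abs]
    exact_mod_cast hk
  have h1 : (1 : ℝ) ≤ (max (|((s k : ℤ) : ℝ)| - 1) 0) ^ 2 := by
    have : (1 : ℝ) ≤ max (|((s k : ℤ) : ℝ)| - 1) 0 := le_max_of_le_left (by linarith)
    nlinarith
  calc μ k = μ k * 1 := (mul_one _).symm
    _ ≤ μ k * (max (|((s k : ℤ) : ℝ)| - 1) 0) ^ 2 := mul_le_mul_of_nonneg_left h1 (hμ k)
    _ ≤ ∑ k, μ k * (max (|((s k : ℤ) : ℝ)| - 1) 0) ^ 2 :=
        Finset.single_le_sum (f := fun k => μ k * (max (|((s k : ℤ) : ℝ)| - 1) 0) ^ 2)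
          (fun k _ => mul_nonneg (hμ k) (sq_nonneg _)) (Finset.mem_univ k)

/-! ## §3. `PerSep` from the 27 nearest translates -/

/-- ★ **`PerSep` FROM A FINITE CHECK**: with a Gram minorant `μ_k ≥ 49/100` (every cell direction at least `7/10` thick), the periodic configuration
is `7/10`-separated as soon as the `27·N₀²` pairs with translates `s ∈ {−1,0,1}³` are (`(m ≠ m' ∨ s ≠ 0) → 7/10 ≤ dist`). [folklore] -/
theorem perSep_of_box {N₀ : ℕ} {x : Fin N₀ → E3} {a : Fin 3 → E3} {x₀ : E3} {ξ : Fin N₀ → Fin 3 → ℝ}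
    (hx : ∀ m, x m = x₀ + ∑ k, ξ m k • a k) (hξ : ∀ m m' k, |ξ m' k - ξ m k| ≤ 1) {G : Fin 3 → Fin 3 → ℝ}
    (hG : ∀ j k, ⟪a j, a k⟫ = G j k) {μ : Fin 3 → ℝ} (hμ : ∀ k, 49 / 100 ≤ μ k)
    (hD : ∀ c : Fin 3 → ℝ, ∑ k, μ k * c k ^ 2 ≤ ∑ j, ∑ k, c j * c k * G j k)
    (hnear : ∀ (m m' : Fin N₀) (s : Fin 3 → ℤ), (∀ k, |s k| ≤ 1) → (m ≠ m' ∨ s ≠ 0) → (7 : ℝ) / 10 ≤ dist (x m) (x m' + latVec a s)) :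
    PerSep x a := by
  intro m m' s hms
  by_cases hs : ∀ k, |s k| ≤ 1
  · exact hnear m m' s hs hms
  · push Not at hs
    obtain ⟨k, hk⟩ := hs
    have hμ0 : ∀ k, 0 ≤ μ k := fun k => le_trans (by norm_num) (hμ k)
    have h := mu_le_dist_sq_of_two_le hx hξ hG hμ0 hD m m' (s := s) (k := k) (by omega)
    have h2 : ((7 : ℝ) / 10) ^ 2 ≤ dist (x m) (x m' + latVec a s) ^ 2 := by nlinarith [hμ k]
    exact (pow_le_pow_iff_left₀ (by norm_num) dist_nonneg two_ne_zero).1 h2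

/-! ## §4. Range cut: far translates contribute nothing -/

/-- **Range cut**: a potential vanishing from `R ≥ 0` on is zero at every translate outside the box `R² ≤ Σ_k μ_k max(|s_k| − 1, 0)²`. [folklore] -/
theorem eq_zero_of_box {N₀ : ℕ} {x : Fin N₀ → E3} {a : Fin 3 → E3} {x₀ : E3} {ξ : Fin N₀ → Fin 3 → ℝ}
    (hx : ∀ m, x m = x₀ + ∑ k, ξ m k • a k) (hξ : ∀ m m' k, |ξ m' k - ξ m k| ≤ 1) {G : Fin 3 → Fin 3 → ℝ}
    (hG : ∀ j k, ⟪a j, a k⟫ = G j k) {μ : Fin 3 → ℝ} (hμ : ∀ k, 0 ≤ μ k)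
    (hD : ∀ c : Fin 3 → ℝ, ∑ k, μ k * c k ^ 2 ≤ ∑ j, ∑ k, c j * c k * G j k) {W : ℝ → ℝ} {R : ℝ} (hR : 0 ≤ R)
    (hW : ∀ r, R ≤ r → W r = 0) (m m' : Fin N₀) (s : Fin 3 → ℤ) (hfar : R ^ 2 ≤ ∑ k, μ k * (max (|((s k : ℤ) : ℝ)| - 1) 0) ^ 2) :
    W (dist (x m) (x m' + latVec a s)) = 0 :=
  hW _ (dist_ge_of_box hx hξ hG hμ hD hR m m' s hfar)

/-- **Coordinate test for the box**: if `R² ≤ μ_k·(B − 1)²` and `B ≤ |s_k|` for some `k` (`1 ≤ B`), the translate is outside the `R`-box. [folklore] -/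
theorem far_of_coord {μ : Fin 3 → ℝ} (hμ : ∀ k, 0 ≤ μ k) {R : ℝ} {B : ℕ} (hB : 1 ≤ B) {s : Fin 3 → ℤ} {k : Fin 3}
    (hk : (B : ℤ) ≤ |s k|) (hRB : R ^ 2 ≤ μ k * ((B : ℝ) - 1) ^ 2) :
    R ^ 2 ≤ ∑ k, μ k * (max (|((s k : ℤ) : ℝ)| - 1) 0) ^ 2 := by
  have hk' : (B : ℝ) ≤ |((s k : ℤ) : ℝ)| := by
    rw [← Int.cast_abs]
    exact_mod_cast hk
  have hB' : (1 : ℝ) ≤ B := by exact_mod_cast hB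
  have h1 : ((B : ℝ) - 1) ^ 2 ≤ (max (|((s k : ℤ) : ℝ)| - 1) 0) ^ 2 := by
    have : (B : ℝ) - 1 ≤ max (|((s k : ℤ) : ℝ)| - 1) 0 := le_max_of_le_left (by linarith)
    exact pow_le_pow_left₀ (by linarith) this 2
  calc R ^ 2 ≤ μ k * ((B : ℝ) - 1) ^ 2 := hRB
    _ ≤ μ k * (max (|((s k : ℤ) : ℝ)| - 1) 0) ^ 2 := mul_le_mul_of_nonneg_left h1 (hμ k)
    _ ≤ ∑ k, μ k * (max (|((s k : ℤ) : ℝ)| - 1) 0) ^ 2 :=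
        Finset.single_le_sum (f := fun k => μ k * (max (|((s k : ℤ) : ℝ)| - 1) 0) ^ 2)
          (fun k _ => mul_nonneg (hμ k) (sq_nonneg _)) (Finset.mem_univ k)

end Summit.AtomisticToContinuum.Crystallization.Theorems.FrustratedLawDichotomyPeriodicFarField

end
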